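import Summits.BirchSwinnertonDyer.BirchSwinnertonDyer.Theorems.SmallImageMuTransferMuTransferX9EulerFactorModP
import Summits.BirchSwinnertonDyer.BirchSwinnertonDyer.Theorems.ByReductionTypeAtTwoOrdKatoHalfAtTwoIsoSteinbergSahTwist
import Literature.NumberTheory.GaloisRepresentations.CyclotomicCharacterFrobeniusProofs
import Literature.NumberTheory.EllipticCurves.Kato2004.IwasawaH1ReductionInfty
import HarnessLib

/-!
# Route ByReductionTypeAtTwo, crux `OrdKatoHalfAtTwoIso` (stmt-BirchSwinnertonDyer-19573), line `steinberg-fibre-at-two`,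
# registered stub `stub_HK_kolyvaginRankOneTwo` (Ω2 = H-K), interior step (B): the EULER FACTOR MODULO 2 at a
# TRANSPOSITION Frobenius, and the FINITE DEPTH of an arithmetic Frobenius in the cyclotomic `ℤ₂`-tower

Seat `cruxlead-stmt-BirchSwinnertonDyer-19573-g0` (LEAD PROVER, MODE LINE; HOME `run/shared/lean/pub/bsd-2adic/`).
THEOREMS ONLY. HONEST FRAMING (cell bsd-2adic): BSD is not proved by any of this; the crux is not proved; `--supports`
helper toward the lead's registered research stub `stub_HK_kolyvaginRankOneTwo : KolyvaginRankOneTwo` (skeleton v5),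
closing nothing. These are the `p = 2` inputs of the value-input step (odd twin: `TameClass.exists_tameCocycle_valueInput`,
`Theorems/SmallImageMuTransferMuTransferX9TameClassValueInput.lean`, which uses `map_toZMod_rubinEulerFactor_eq_of_galoisRepTorsion_eq_one`
— `P_q ≡ (1 − X)² (mod p)` at an `E`-SPLIT Frobenius — and the EXACT depth of the Frobenius, both supplied there by
Step 2 of the odd core).

* §1 `units_zmod_two_eq_one` — `(ℤ/2)ˣ = 1`.
* §2 `exists_ne_zero_smul_eq_of_galoisRepTorsion_mul_self_eq_one` — an element acting on `E[2]` with square `1` fixes a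
  non-zero `2`-torsion point (a permutation of `{T₀,T₁,T₂}` of order `≤ 2` has a fixed point: `decide`).
* §3 `frobeniusTrace_natCast_zmod_two_eq_zero`, `map_toZMod_rubinEulerFactor_two` — at a good odd place whose
  Frobenius has square `1` on `E[2]` (in particular a TRANSPOSITION), `a_q` is even and Rubin's Euler factor
  `P(Fr⁻¹ | T₂E*; X) = 1 − (a_q/q)X + (1/q)X²` reduces to `(1 − X)² = 1 + X²` modulo `2` (Thorne's
  `tr ρ̄(Fr) = 1 + χ̄(Fr)` for a Frobenius with a fixed vector, `χ̄₂ = 1`).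
* §4 `not_mem_kerSubgroup_of_isArithFrobAt`, `exists_depth_of_isArithFrobAt` — for the CYCLOTOMIC `ℤ_p`-extension and an
  arithmetic Frobenius `Fr` at a finite place `v ∤ p`: `κ(Fr) ≠ 0` (`χ_p(Fr) = N v ≥ 2` is not a root of unity in `ℤ_p`),
  hence `Fr ∈ Γ^{p^d} ∖ Γ^{p^{d+1}}` for a unique depth `d`.

References: K. Rubin, *Euler Systems* (2000) Def. 2.1.1 [Rubin2000]; J.-P. Serre, *Abelian ℓ-adic representations*
(1968) I-1.2 [SerreAbelianLadic1968]; L. Washington, *Introduction to Cyclotomic Fields* (1997) §13.1 [Washington1997];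
J.-P. Serre, Invent. Math. 15 (1972) §5.3 [Serre1972].
-/

set_option linter.dupNamespace false
set_option autoImplicit false

noncomputable section

open scoped NumberField
open Polynomial Field IsDedekindDomain
open Literature.NumberTheory.GaloisRepresentations
open Literature.NumberTheory.EllipticCurves Literature.NumberTheory.EllipticCurves.Kato2004
open Literature.NumberTheory.EllipticCurves.Kato2004.EulerSystemValues
open Literature.NumberTheory.EllipticCurves.DokchitserDokchitser2012
open WeierstrassCurve (geomPoints geomTorsion)

namespace Summit.BirchSwinnertonDyer.BirchSwinnertonDyer.Theorems.SteinbergFibreAtTwo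

/-! ## §1 `(ℤ/2)ˣ` is trivial -/

/-- `2 = 0` in `ℤ/2`. [folklore] -/
theorem two_eq_zero_zmod_two : (2 : ZMod 2) = 0 := by decide

/-- `1 + 1 = 0` in `ℤ/2`. [folklore] -/
theorem one_add_one_zmod_two : (1 : ZMod 2) + 1 = 0 := by decide

/-- Every unit of `ℤ/2` is `1`. [folklore] -/
theorem units_zmod_two_eq_one (u : (ZMod 2)ˣ) : u = 1 := by
  have : Fintype.card (ZMod 2)ˣ = 1 := by rw [ZMod.card_units_eq_totient]; rfl
  exact Fintype.card_le_one_iff.mp this.le u 1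

/-! ## §2 An element of square `1` on `E[2]` fixes a non-zero `2`-torsion point -/

/-- A permutation of three letters of order dividing `2` has a fixed point. [folklore] -/
theorem perm_fin_three_exists_fixed_of_mul_self_eq_one :
    ∀ g : Equiv.Perm (Fin 3), g * g = 1 → ∃ i, g i = i := by
  decide

variable (W : WeierstrassCurve ℚ) [W.IsElliptic]

/-- **An element `Fr ∈ Γ_ℚ` with `ρ̄_{E,2}(Fr)² = 1` fixes a non-zero point of `E[2]`** (it permutes the three
non-zero points `T₀, T₁, T₂` by a permutation of order `≤ 2`, which has a fixed letter). In particular a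
TRANSPOSITION Frobenius has a rational `2`-torsion point modulo `q`. [cite: Serre1972, §5.3] -/
theorem exists_ne_zero_smul_eq_of_galoisRepTorsion_mul_self_eq_one {Fr : absoluteGaloisGroup ℚ}
    (h2 : WeierstrassCurve.galoisRepTorsion W 2 (Fr * Fr) = 1) :
    ∃ P : geomTorsion W (2 : ℤ), P ≠ 0 ∧ Fr • P = P := by
  have htwo : (2 : ℚ) ≠ 0 := two_ne_zero
  -- `permGal (Fr * Fr) = 1`
  have hperm : permGal W htwo Fr * permGal W htwo Fr = 1 := by
    rw [← permGal_mul]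
    exact (forall_smul_eq_iff_permGal_eq_one W (Fr * Fr)).mp
      ((mem_ker_galoisRepTorsion_two_iff W (Fr * Fr)).mp (by rw [MonoidHom.mem_ker, h2]))
  obtain ⟨i, hi⟩ := perm_fin_three_exists_fixed_of_mul_self_eq_one _ hperm
  refine ⟨T W htwo i, fun h0 => coe_T_ne_zero W htwo i (by rw [h0]; rfl), ?_⟩
  rw [← T_permGal, hi]

/-! ## §3 The Euler factor modulo `2` at a Frobenius of square `1` on `E[2]` -/

section EulerFactor

variable [W.IsGloballyMinimal] [ContinuousSMul ℤ_[2] (W.tateModule 2)]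

omit [ContinuousSMul ℤ_[2] (W.tateModule 2)] in
/-- **`a_q` is even when the Frobenius at `q` has square `1` on `E[2]`** (`q ∤ 2` good): by §2 the Frobenius fixes a
non-zero `2`-torsion point, so Thorne's triangular form gives `tr ρ̄₂(Fr) = 1 + χ̄₂(Fr) = 1 + 1 = 0` in `𝔽₂`, and
`tr ρ̄₂(Fr) ≡ a_q`. [cite: Serre1972, §5.3] [cite: SilvermanAEC2009, V.2.3.1] -/
theorem frobeniusTrace_natCast_zmod_two_eq_zero {v : HeightOneSpectrum (𝓞 ℚ)}
    (hne : ((Rat.HeightOneSpectrum.primesEquiv v : Nat.Primes) : ℕ) ≠ 2) (hgood : W.HasGoodReductionAt v)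
    {𝔓 : Ideal (absIntegers (𝓞 ℚ) ℚ)} (h𝔓 : 𝔓 ∈ v.primesAbove) {Fr : absoluteGaloisGroup ℚ}
    (hFr : IsArithFrobAt (𝓞 ℚ) Fr 𝔓) (h2 : WeierstrassCurve.galoisRepTorsion W 2 (Fr * Fr) = 1) :
    (W.frobeniusTrace (Rat.HeightOneSpectrum.primesEquiv v) : ZMod 2) = 0 := by
  haveI : Fact (2 : ℕ).Prime := ⟨Nat.prime_two⟩
  set q : ℕ := ((Rat.HeightOneSpectrum.primesEquiv v : Nat.Primes) : ℕ) with hq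
  haveI : Fact q.Prime := ⟨(Rat.HeightOneSpectrum.primesEquiv v).2⟩
  have hgood' : W.HasGoodReductionAtPrime q :=
    (WeierstrassCurve.hasGoodReductionAtPrime_primesEquiv_iff_holds W v q rfl).mpr hgood
  obtain ⟨P, hP0, hP⟩ := exists_ne_zero_smul_eq_of_galoisRepTorsion_mul_self_eq_one W h2
  have htr := W.trace_galoisRepTorsion_frobenius_eq 2 (p := q) hne hgood' rfl h𝔓 hFr
  have htr' := Literature.NumberTheory.Automorphic.Thorne2019.trace_galoisRepTorsion_eq_one_add_of_smul_eq
    W 2 Fr hP0 hP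
  rw [htr', units_zmod_two_eq_one (modPCyclotomicCharacterZMod ℚ 2 Fr), Units.val_one] at htr
  rw [← htr]
  exact one_add_one_zmod_two

variable [Module.Free ℤ_[2] (W.tateModule 2)] [Module.Finite ℤ_[2] (W.tateModule 2)]

/-- **The Euler factor of a Frobenius of square `1` on `E[2]` is `(1 − X)²` modulo `2`.** At a good place
`v ∤ 2` with arithmetic Frobenius `Fr`, `ρ̄₂(Fr)² = 1`: Rubin's Euler factor
`P(Fr⁻¹ | T₂E*; X) = 1 − (a_q/q)X + (1/q)X²` (`Rat.rubinEulerFactor_galoisRepTate`) reduces to `1 + X² = (1 − X)²`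
over `𝔽₂` (`q` odd, `a_q` even). The `p = 2` twin of `EulerFactorModP.map_toZMod_rubinEulerFactor_eq_of_galoisRepTorsion_eq_one`;
it feeds the norm relation of the tame class (`TameClass.exists_tameClass_of_isEulerSystemClassTwo`) in operator form
`cores y = (φ̃ − 1)²·z`. [cite: Rubin2000, Def. 2.1.1] [cite: Serre1972, §5.3] -/
theorem map_toZMod_rubinEulerFactor_two {v : HeightOneSpectrum (𝓞 ℚ)}
    (hne : ((Rat.HeightOneSpectrum.primesEquiv v : Nat.Primes) : ℕ) ≠ 2) (hgood : W.HasGoodReductionAt v)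
    {𝔓 : Ideal (absIntegers (𝓞 ℚ) ℚ)} (h𝔓 : 𝔓 ∈ v.primesAbove) {Fr : absoluteGaloisGroup ℚ}
    (hFr : IsArithFrobAt (𝓞 ℚ) Fr 𝔓) (h2 : WeierstrassCurve.galoisRepTorsion W 2 (Fr * Fr) = 1) :
    (rubinEulerFactor (tateRep W 2).toRepresentation (cyclotomicCharacterToUnits ℚ 2 ℤ_[2]) Fr).map
        (PadicInt.toZMod (p := 2)) = ((1 - X) ^ 2 : ℤ[X]).map (Int.castRingHom (ZMod 2)) := by
  haveI : Fact (2 : ℕ).Prime := ⟨Nat.prime_two⟩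
  obtain ⟨u, hu, hP⟩ :=
    Summit.BirchSwinnertonDyer.Rank1Residual.GaloisImage.CyclotomicLevel.Rat.rubinEulerFactor_galoisRepTate
      W 2 hne hgood ⟨𝔓, h𝔓, hFr⟩
  -- `q` is odd: `q ≡ 1 (mod 2)`
  have hq1 : (((Rat.HeightOneSpectrum.primesEquiv v : Nat.Primes) : ℕ) : ZMod 2) = 1 := by
    have hodd := ((Rat.HeightOneSpectrum.primesEquiv v).2.eq_two_or_odd').resolve_left hne
    obtain ⟨k, hk⟩ := hodd
    rw [hk, Nat.cast_add, Nat.cast_mul, Nat.cast_ofNat, Nat.cast_one, two_eq_zero_zmod_two, zero_mul,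
      zero_add]
  have ha0 := frobeniusTrace_natCast_zmod_two_eq_zero W hne hgood h𝔓 hFr h2
  have hu1 : PadicInt.toZMod (u : ℤ_[2]) = 1 := by rw [hu, map_natCast, hq1]
  have hui : PadicInt.toZMod (↑u⁻¹ : ℤ_[2]) = 1 := by
    have h := congrArg (PadicInt.toZMod (p := 2)) (u.inv_mul : (↑u⁻¹ : ℤ_[2]) * ↑u = 1)
    rwa [map_mul, hu1, mul_one, map_one] at h
  have hcoef : PadicInt.toZMod
      ((↑u⁻¹ : ℤ_[2]) * (W.frobeniusTrace (Rat.HeightOneSpectrum.primesEquiv v) : ℤ_[2])) = 0 := by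
    rw [map_mul, hui, one_mul, map_intCast, ha0]
  change (rubinEulerFactor (W.galoisRepTate 2) (cyclotomicCharacterToUnits ℚ 2 ℤ_[2]) Fr).map
    PadicInt.toZMod = _
  rw [hP]
  simp only [Polynomial.map_add, Polynomial.map_sub, Polynomial.map_one, Polynomial.map_mul,
    Polynomial.map_pow, Polynomial.map_X, Polynomial.map_C, hcoef, hui]
  -- `1 - C 0 * X + C 1 * X ^ 2 = (1 - X) ^ 2` over `𝔽₂`
  rw [map_one, one_mul, map_zero, zero_mul, sub_zero]
  have h2 : (2 : (ZMod 2)[X]) = 0 := by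
    rw [show (2 : (ZMod 2)[X]) = C (2 : ZMod 2) from (map_ofNat C 2).symm, two_eq_zero_zmod_two, map_zero]
  have : ((1 : (ZMod 2)[X]) - X) ^ 2 = 1 + X ^ 2 - 2 * X := by ring
  rw [this, h2, zero_mul, sub_zero]

end EulerFactor

/-! ## §4 The depth of an arithmetic Frobenius in the cyclotomic tower is finite -/

section Depth

variable {K : Type} [Field K] [NumberField K] {p : ℕ} [Fact p.Prime] (κ : ZpExtension K p)

/-- **An arithmetic Frobenius at `v ∤ p` is NOT in `ker κ` for the CYCLOTOMIC `ℤ_p`-extension**: `ker κ = χ_p⁻¹(μ(ℤ_p))`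
(`ZpExtension.IsCyclotomic`) and `χ_p(Fr) = N v ≥ 2` (`GaloisRep.cyclotomicCharacter_apply_of_isArithFrobAt`) is not
of finite order in `ℤ_pˣ` (`(N v)^n = 1` in `ℤ_p` forces `N v = 1`). I.e. no finite prime away from `p` splits
completely in `K_∞`. [cite: Washington1997, §13.1] [cite: SerreAbelianLadic1968, Ch. I §1.2] -/
theorem not_mem_kerSubgroup_of_isArithFrobAt (hκ : κ.IsCyclotomic)
    {v : HeightOneSpectrum (𝓞 K)} (hv : (p : 𝓞 K) ∉ v.asIdeal)
    {𝔓 : Ideal (absIntegers (𝓞 K) K)} (h𝔓 : 𝔓 ∈ v.primesAbove)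
    {Fr : absoluteGaloisGroup K} (hFr : IsArithFrobAt (𝓞 K) Fr 𝔓) : Fr ∉ κ.kerSubgroup := by
  intro hmem
  have hκ' : κ.kerSubgroup =
      (CommGroup.torsion ℤ_[p]ˣ).comap (GaloisRep.cyclotomicCharacter K p).toMonoidHom := hκ
  rw [hκ', Subgroup.mem_comap, CommGroup.mem_torsion, isOfFinOrder_iff_pow_eq_one] at hmem
  obtain ⟨n, hn, hpow⟩ := hmem
  have hχ := GaloisRep.cyclotomicCharacter_apply_of_isArithFrobAt (K := K) (ℓ := p) hv h𝔓 hFr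
  -- `(N v : ℤ_p) ^ n = 1`
  have h1 : ((v.residueCard : ℕ) : ℤ_[p]) ^ n = 1 := by
    have := congrArg (fun x : ℤ_[p]ˣ => (x : ℤ_[p])) hpow
    simp only [Units.val_pow_eq_pow_val, Units.val_one] at this
    change ((GaloisRep.cyclotomicCharacter K p Fr : ℤ_[p]ˣ) : ℤ_[p]) ^ n = 1 at this
    rwa [hχ] at this
  have h2 : (v.residueCard : ℕ) ^ n = 1 := by exact_mod_cast h1
  have hlt : 1 < v.residueCard := v.one_lt_residueCard
  rcases pow_eq_one_iff.mp h2 with h | h <;> omega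

/-- **The depth of an arithmetic Frobenius in the cyclotomic `ℤ_p`-tower**: for `v ∤ p` and an arithmetic Frobenius
`Fr` at a prime above `v` there is a (unique) `d` with `Fr ∈ Γ^{p^d} ∖ Γ^{p^{d+1}}` (`Γ^{p^m} = Gal(K̄/K_m) =
κ.layerSubgroup m`): `Γ^{p^0} = Γ_K` and `⋂_m Γ^{p^m} = ker κ ∌ Fr`. At `p = 2` this is the `d` with `q ≡ ±1 + 2^{d+2}`
odd part… (no congruence is asserted). [cite: Washington1997, §13.1] -/
theorem exists_depth_of_isArithFrobAt (hκ : κ.IsCyclotomic)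
    {v : HeightOneSpectrum (𝓞 K)} (hv : (p : 𝓞 K) ∉ v.asIdeal)
    {𝔓 : Ideal (absIntegers (𝓞 K) K)} (h𝔓 : 𝔓 ∈ v.primesAbove)
    {Fr : absoluteGaloisGroup K} (hFr : IsArithFrobAt (𝓞 K) Fr 𝔓) :
    ∃ d : ℕ, Fr ∈ κ.layerSubgroup d ∧ Fr ∉ κ.layerSubgroup (d + 1) := by
  classical
  have hex : ∃ m, Fr ∉ κ.layerSubgroup m := by
    by_contra h
    push Not at h
    exact not_mem_kerSubgroup_of_isArithFrobAt κ hκ hv h𝔓 hFr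
      (κ.mem_kerSubgroup_of_forall_mem_layerSubgroup h)
  have h0 : Nat.find hex ≠ 0 := by
    intro h
    have := Nat.find_spec hex
    rw [h, κ.layerSubgroup_zero] at this
    exact this (Subgroup.mem_top Fr)
  refine ⟨Nat.find hex - 1, ?_, ?_⟩
  · have := Nat.find_min hex (m := Nat.find hex - 1) (by omega)
    push Not at this
    exact this
  · rw [Nat.sub_add_cancel (Nat.one_le_iff_ne_zero.mpr h0)]
    exact Nat.find_spec hex

omit [NumberField K] in
/-- The depth `d` of `Fr` dominates every layer containing `Fr`: `Fr ∈ Γ^{p^n} ⟹ n ≤ d`. [cite: Washington1997, §13.1] -/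
theorem le_depth_of_mem_layerSubgroup {Fr : absoluteGaloisGroup K} {d n : ℕ}
    (hd : Fr ∉ κ.layerSubgroup (d + 1)) (hn : Fr ∈ κ.layerSubgroup n) : n ≤ d := by
  by_contra h
  push Not at h
  exact hd (κ.layerSubgroup_antitone (Nat.succ_le_of_lt h) hn)

end Depth

end Summit.BirchSwinnertonDyer.BirchSwinnertonDyer.Theorems.SteinbergFibreAtTwo

end
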